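import Summits.CriticalPhenomena.PercolationContinuityZ3.Theorems.PercNearOneGluingNoHeavyLowerTailKnQuestion8PocketSetDual
import HarnessLib

/-!
# KN Question 8 / MC-D at three relays — superadditivity of the pocket odds, I: the exchange step EXCH-X

Support file (`--supports stmt-CriticalPhenomena-4575`, closed), prover `prim-lf-2` (gen 19).  No definitions, no named facts, no sorries;
standard axioms.  Memo `prim-lf-2/PXI-gen19.md` §0(2), §3.  Part I of three (II: `…PocketOddsStep.lean`, III: `…PocketOdds.lean`).

Setting (memos POCKET-CERT-gen16 §1, PXI-gen19 §0): one finite weighted graph, observer `o`, relays `x, y` and the designated relay `z`,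
a down-closed pocket family `𝒟` of vertex sets (none containing the relays, as needed), pocket event `P = {C_o ∈ 𝒟}`.  With
`E1 = {x↮y} ∩ {x↮z}`, `E2 = {y↮x} ∩ {y↮z}`, `F = {x↔y} ∩ {x↮z}` and the O:P likelihood ratios
`r_x = μ({x↔o} ∩ E1)/μ(P ∩ E1)`, `r_y = μ({y↔o} ∩ E2)/μ(P ∩ E2)`, `r_xy = μ({x↔o} ∩ F)/μ(P ∩ F)`, the inequality
  **(club)  `r_xy ≥ r_x + r_y`**   ("superadditivity of the pocket odds")
is the instance `U = {y ∈ C_x}` of the pair-functional pocket covariance comparison PCOV^ξ (memo PXI-gen19 §0(1)); equivalently the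
instance `G = 1{y ∈ ·}` of PCOV (prim-lf-2 gen 16/17; tree `PocketCert.block41_three_of_pcovZ`).  prim-lf-2 gen 19 census: 1 174/1 174,
sharp (ratio up to 0.9993).  Its proof has three steps, all positive association of a SET cluster (vdBHK Thm 2.1) in exchange form:
EXCH-X (`S = {x,y,o}`, `T = {z}`), Step 1 for `(x,y)` and for `(y,x)` (`S = {y,z}`, `T = {x,o}` after exploring `C_S`, vdBHK Lemma 2.4 =
tree `PocketCert.tower_setCl`), and the mediant inequality.
THIS FILE:
* `PocketCert.exch_of_pa` — the exchange algebra: two positive-association inequalities give `μ(hA)·μ(fB) ≤ μ(fA)·μ(hB)`;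
* `PocketCert.pocket_exchX` — with `X = {x,y,z pairwise separated}`:  `(μ({x↔o}∩X) + μ({y↔o}∩X)) · μ(P∩F) ≤ μ({x↔o}∩F) · μ(P∩X)`
  (`1{o ↔ {x,y}}`, `1{x↔y}` increasing and `1_P` decreasing in the edge cluster of `{x,y,o}`, given `{x,y,o} ↮ z`).
[cite: VandenbergHaggstromKahn2005, Thm. 2.1 (p. 9), §2.1 Lemma 2.4 (p. 10)] [cite: KozmaNitzan2024, Questions 8–9 (§5.5 p. 36)]
-/

namespace Summit.CriticalPhenomena.PercolationContinuityZ3.Theorems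

open MeasureTheory Set Literature.Probability.LatticeModels Literature.Probability.Percolation
open scoped Classical
open KNPreFKG BHK2006

noncomputable section

namespace PocketCert

variable {V : Type*} [Fintype V]

omit [Fintype V] in
/-- **Exchange algebra.**  From the two positive-association inequalities `(fA + fB)·A ≤ D·fA` (for `f`) and `D·hA ≤ (hA + hB)·A`
(for `h`), with everything nonnegative and `hA ≤ A`: `hA·fB ≤ fA·hB`. [folklore] -/
theorem exch_of_pa (D A fA fB hA hB : ℝ) (hA0 : 0 ≤ A) (hfA : 0 ≤ fA) (hhA : 0 ≤ hA) (hhB : 0 ≤ hB) (hAle : hA ≤ A) (h1 : (fA + fB) * A ≤ D * fA) (h2 : D * hA ≤ (hA + hB) * A) :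
    hA * fB ≤ fA * hB := by
  rcases eq_or_lt_of_le hA0 with hAz | hApos
  · have hz : hA = 0 := le_antisymm (hAz ▸ hAle) hhA
    rw [hz, zero_mul]; exact mul_nonneg hfA hhB
  · -- multiply `h1` by `hA` and `h2` by `fA`
    have e1 : (fA + fB) * A * hA ≤ D * fA * hA := mul_le_mul_of_nonneg_right h1 hhA
    have e2 : D * hA * fA ≤ (hA + hB) * A * fA := mul_le_mul_of_nonneg_right h2 hfA
    have e3 : A * (hA * fB - fA * hB) ≤ 0 := by nlinarith [e1, e2]
    nlinarith [e3, hApos]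

/-- **EXCH-X.**  `𝒟` down-closed with `z` in no member, `P = {C_o ∈ 𝒟}`, `X = {x↮y} ∩ {x↮z} ∩ {y↮z}`:
`(μ({x↔o} ∩ X) + μ({y↔o} ∩ X)) · μ(P ∩ {x↔y} ∩ {x↮z}) ≤ μ({x↔o} ∩ {x↔y} ∩ {x↮z}) · μ(P ∩ X)`
— positive association of the edge cluster of `S = {x, y, o}` given `S ↮ z` (vdBHK Thm 2.1), in exchange form: `1{o ↔ {x,y}}` and
`1{x↔y}` are increasing, `1_P` is decreasing.
[cite: VandenbergHaggstromKahn2005, Thm. 2.1 (p. 9)] [cite: KozmaNitzan2024, Questions 8–9 (§5.5 p. 36)] -/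
theorem pocket_exchX (w : Sym2 V → unitInterval) (o x y z : V) (𝒟 : Set (Set V)) (h𝒟 : IsLowerSet 𝒟)
    (hz : ∀ W ∈ 𝒟, z ∉ W) :
    ((prodBernoulli w).real (openConn x o ∩ ({ω | ¬ (openGraph ω).Reachable x y} ∩ {ω | ¬ (openGraph ω).Reachable x z} ∩
          {ω | ¬ (openGraph ω).Reachable y z})) +
        (prodBernoulli w).real (openConn y o ∩ ({ω | ¬ (openGraph ω).Reachable x y} ∩ {ω | ¬ (openGraph ω).Reachable x z} ∩
          {ω | ¬ (openGraph ω).Reachable y z}))) *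
        (prodBernoulli w).real ({ω : BondConfig V | openCluster ω o ∈ 𝒟} ∩ (openConn x y ∩ {ω | ¬ (openGraph ω).Reachable x z})) ≤
      (prodBernoulli w).real (openConn x o ∩ openConn x y ∩ {ω | ¬ (openGraph ω).Reachable x z}) *
        (prodBernoulli w).real ({ω : BondConfig V | openCluster ω o ∈ 𝒟} ∩ ({ω | ¬ (openGraph ω).Reachable x y} ∩
          {ω | ¬ (openGraph ω).Reachable x z} ∩ {ω | ¬ (openGraph ω).Reachable y z})) := by
  classical
  set μ := prodBernoulli w with hμ
  have hmeas : ∀ S' : Set (BondConfig V), MeasurableSet S' := fun _ => MeasurableSet.of_discrete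
  have hn := fun (S' : Set (BondConfig V)) => (measureReal_nonneg : 0 ≤ μ.real S')
  set S : Set V := {x, y, o} with hS
  set T : Set V := {z} with hT
  set D : Set (BondConfig V) := {ω : BondConfig V | ∀ s ∈ S, ∀ t ∈ T, ¬ (openGraph ω).Reachable s t} with hD
  set X : Set (BondConfig V) := {ω | ¬ (openGraph ω).Reachable x y} ∩ {ω | ¬ (openGraph ω).Reachable x z} ∩
      {ω | ¬ (openGraph ω).Reachable y z} with hX
  set P : Set (BondConfig V) := {ω : BondConfig V | openCluster ω o ∈ 𝒟} with hP
  set Eo : Set (BondConfig V) := openConn x o ∪ openConn y o with hEo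
  set A : Set (BondConfig V) := openConn x y with hA
  -- three monotone functions of the edge cluster of `S`
  set Ff : Set (Sym2 V) → ℝ := fun C => if (o ∈ openCluster C x ∨ o ∈ openCluster C y) then 1 else 0 with hFf
  set GA : Set (Sym2 V) → ℝ := fun C => (openCluster C x).indicator (1 : V → ℝ) y with hGA
  set Fh : Set (Sym2 V) → ℝ := fun C => if openCluster C o ∈ 𝒟 then 0 else 1 with hFh
  have hFf_mono : Monotone Ff := by
    intro C C' hCC'
    simp only [hFf]
    by_cases h : o ∈ openCluster C x ∨ o ∈ openCluster C y
    · have h' : o ∈ openCluster C' x ∨ o ∈ openCluster C' y :=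
        h.imp (fun h1 => openCluster_mono hCC' x h1) (fun h1 => openCluster_mono hCC' y h1)
      rw [if_pos h, if_pos h']
    · rw [if_neg h]; split_ifs <;> norm_num
  have hGA_mono : Monotone GA := by
    intro C C' hCC'
    simp only [hGA]
    by_cases h : y ∈ openCluster C x
    · rw [indicator_of_mem h, indicator_of_mem (openCluster_mono hCC' x h)]
    · rw [indicator_of_notMem h]
      by_cases h' : y ∈ openCluster C' x
      · rw [indicator_of_mem h']; simp
      · rw [indicator_of_notMem h']
  have hFh_mono : Monotone Fh := by
    intro C C' hCC'
    simp only [hFh]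
    by_cases h' : openCluster C' o ∈ 𝒟
    · rw [if_pos h', if_pos (h𝒟 (openCluster_mono hCC' o) h')]
    · rw [if_neg h']; split_ifs <;> norm_num
  have hxS : x ∈ S := by simp [hS]
  have hyS : y ∈ S := by simp [hS]
  have hoS : o ∈ S := by simp [hS]
  have hclx : ∀ ω : BondConfig V, openCluster (⋃ s ∈ S, openEdgeCluster ω s) x = openCluster ω x := by
    intro ω; ext a; exact (KNSep.reachable_iff_cluster ω S hxS a).symm
  have hcly : ∀ ω : BondConfig V, openCluster (⋃ s ∈ S, openEdgeCluster ω s) y = openCluster ω y := by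
    intro ω; ext a; exact (KNSep.reachable_iff_cluster ω S hyS a).symm
  have hclo : ∀ ω : BondConfig V, openCluster (⋃ s ∈ S, openEdgeCluster ω s) o = openCluster ω o := by
    intro ω; ext a; exact (KNSep.reachable_iff_cluster ω S hoS a).symm
  have hFf_eq : ∀ ω : BondConfig V, Ff (⋃ s ∈ S, openEdgeCluster ω s) = Eo.indicator 1 ω := by
    intro ω; simp only [hFf, hclx ω, hcly ω]
    by_cases h : o ∈ openCluster ω x ∨ o ∈ openCluster ω y
    · rw [if_pos h, indicator_of_mem (show ω ∈ Eo from h)]; simp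
    · rw [if_neg h, indicator_of_notMem (show ω ∉ Eo from h)]
  have hGA_eq : ∀ ω : BondConfig V, GA (⋃ s ∈ S, openEdgeCluster ω s) = A.indicator 1 ω := by
    intro ω; simp only [hGA, hclx ω]
    by_cases h : (openGraph ω).Reachable x y
    · rw [indicator_of_mem (show y ∈ openCluster ω x from h), indicator_of_mem (show ω ∈ A from h)]; simp
    · rw [indicator_of_notMem (show y ∉ openCluster ω x from h), indicator_of_notMem (show ω ∉ A from h)]
  have hFh_eq : ∀ ω : BondConfig V, Fh (⋃ s ∈ S, openEdgeCluster ω s) = (Pᶜ : Set (BondConfig V)).indicator 1 ω := by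
    intro ω; simp only [hFh, hclo ω]
    by_cases h : openCluster ω o ∈ 𝒟
    · rw [if_pos h, indicator_of_notMem (show ω ∉ (Pᶜ : Set (BondConfig V)) from fun hc => hc h)]
    · rw [if_neg h, indicator_of_mem (show ω ∈ (Pᶜ : Set (BondConfig V)) from h), Pi.one_apply]
  -- (1) positive association of `1{o ↔ {x,y}}` and `1{x↔y}` given `D`
  have h1 := BHK2006_setClusterConditionalPositiveAssociation w S T Ff GA hFf_mono hGA_mono
  simp_rw [hFf_eq, hGA_eq] at h1
  rw [setIntegral_indicator_one_eq μ D Eo, setIntegral_indicator_one_eq μ D A,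
    setIntegral_mul_indicator_one μ D A (Eo.indicator 1), setIntegral_indicator_one_eq μ (D ∩ A) Eo] at h1
  -- h1 : μ(D∩Eo) * μ(D∩A) ≤ μ D * μ(D∩A∩Eo)
  -- (2) positive association of `1{C_o ∉ 𝒟}` and `1{x↔y}` given `D`
  have h2 := BHK2006_setClusterConditionalPositiveAssociation w S T Fh GA hFh_mono hGA_mono
  simp_rw [hFh_eq, hGA_eq] at h2
  rw [setIntegral_indicator_one_eq μ D Pᶜ, setIntegral_indicator_one_eq μ D A,
    setIntegral_mul_indicator_one μ D A ((Pᶜ : Set (BondConfig V)).indicator 1),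
    setIntegral_indicator_one_eq μ (D ∩ A) Pᶜ] at h2
  -- complements inside `D` and `D ∩ A`
  have c1 : μ.real (D ∩ Pᶜ) = μ.real D - μ.real (D ∩ P) := by
    have := measureReal_inter_add_sdiff₀ (μ := μ) (s := D) (t := P) (hmeas P).nullMeasurableSet
    rw [Set.sdiff_eq] at this; linarith
  have c2 : μ.real (D ∩ A ∩ Pᶜ) = μ.real (D ∩ A) - μ.real (D ∩ A ∩ P) := by
    have := measureReal_inter_add_sdiff₀ (μ := μ) (s := D ∩ A) (t := P) (hmeas P).nullMeasurableSet
    rw [Set.sdiff_eq] at this; linarith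
  rw [c1, c2] at h2
  -- h2 : (μD − μ(D∩P)) * μ(D∩A) ≤ μD * (μ(D∩A) − μ(D∩A∩P))
  -- the cells
  have cf : μ.real (D ∩ Eo) = μ.real (D ∩ A ∩ Eo) + μ.real (D ∩ Eo ∩ Aᶜ) := by
    have := measureReal_inter_add_sdiff₀ (μ := μ) (s := D ∩ Eo) (t := A) (hmeas A).nullMeasurableSet
    rw [Set.sdiff_eq] at this
    have e : D ∩ Eo ∩ A = D ∩ A ∩ Eo := by ext ω; simp only [mem_inter_iff]; tauto
    rw [e] at this; linarith
  have ch : μ.real (D ∩ P) = μ.real (D ∩ A ∩ P) + μ.real (D ∩ P ∩ Aᶜ) := by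
    have := measureReal_inter_add_sdiff₀ (μ := μ) (s := D ∩ P) (t := A) (hmeas A).nullMeasurableSet
    rw [Set.sdiff_eq] at this
    have e : D ∩ P ∩ A = D ∩ A ∩ P := by ext ω; simp only [mem_inter_iff]; tauto
    rw [e] at this; linarith
  have hAle : μ.real (D ∩ A ∩ P) ≤ μ.real (D ∩ A) := measureReal_mono inter_subset_left
  have key := exch_of_pa (μ.real D) (μ.real (D ∩ A)) (μ.real (D ∩ A ∩ Eo)) (μ.real (D ∩ Eo ∩ Aᶜ))
    (μ.real (D ∩ A ∩ P)) (μ.real (D ∩ P ∩ Aᶜ)) (hn _) (hn _) (hn _) (hn _) hAle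
    (by rw [← cf]; exact h1) (by rw [← ch]; nlinarith [h2])
  -- key : μ(D∩A∩P) * μ(D∩Eo∩Aᶜ) ≤ μ(D∩A∩Eo) * μ(D∩P∩Aᶜ)
  -- identify the four cells with the events of the statement
  have hzP : ∀ ω ∈ P, ¬ (openGraph ω).Reachable o z := fun ω hω hoz => hz _ hω hoz
  have hDmem : ∀ ω : BondConfig V, ω ∈ D ↔ (¬ (openGraph ω).Reachable x z ∧ ¬ (openGraph ω).Reachable y z ∧
      ¬ (openGraph ω).Reachable o z) := by
    intro ω
    simp only [hD, hS, hT, mem_setOf_eq, mem_insert_iff, mem_singleton_iff, forall_eq_or_imp, forall_eq]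
  have e1 : D ∩ A ∩ P = P ∩ (openConn x y ∩ {ω | ¬ (openGraph ω).Reachable x z}) := by
    ext ω
    simp only [mem_inter_iff, hDmem, hA, openConn, mem_setOf_eq]
    constructor
    · rintro ⟨⟨⟨hxz, -, -⟩, hxy⟩, hp⟩; exact ⟨hp, hxy, hxz⟩
    · rintro ⟨hp, hxy, hxz⟩
      exact ⟨⟨⟨hxz, fun hyz => hxz (hxy.trans hyz), hzP ω hp⟩, hxy⟩, hp⟩
  have e2 : D ∩ P ∩ Aᶜ = P ∩ X := by
    ext ω
    simp only [mem_inter_iff, mem_compl_iff, hDmem, hA, hX, openConn, mem_setOf_eq]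
    constructor
    · rintro ⟨⟨⟨hxz, hyz, -⟩, hp⟩, hxy⟩; exact ⟨hp, ⟨hxy, hxz⟩, hyz⟩
    · rintro ⟨hp, ⟨hxy, hxz⟩, hyz⟩; exact ⟨⟨⟨hxz, hyz, hzP ω hp⟩, hp⟩, hxy⟩
  have e3 : D ∩ A ∩ Eo = openConn x o ∩ openConn x y ∩ {ω | ¬ (openGraph ω).Reachable x z} := by
    ext ω
    simp only [mem_inter_iff, mem_union, hDmem, hA, hEo, openConn, mem_setOf_eq]
    constructor
    · rintro ⟨⟨⟨hxz, -, -⟩, hxy⟩, hxo | hyo⟩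
      · exact ⟨⟨hxo, hxy⟩, hxz⟩
      · exact ⟨⟨hxy.trans hyo, hxy⟩, hxz⟩
    · rintro ⟨⟨hxo, hxy⟩, hxz⟩
      exact ⟨⟨⟨hxz, fun hyz => hxz (hxy.trans hyz), fun hoz => hxz (hxo.trans hoz)⟩, hxy⟩, Or.inl hxo⟩
  have e4 : D ∩ Eo ∩ Aᶜ = (openConn x o ∩ X) ∪ (openConn y o ∩ X) := by
    ext ω
    simp only [mem_inter_iff, mem_union, mem_compl_iff, hDmem, hA, hEo, hX, openConn, mem_setOf_eq]
    constructor
    · rintro ⟨⟨⟨hxz, hyz, -⟩, hxo | hyo⟩, hxy⟩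
      · exact Or.inl ⟨hxo, ⟨hxy, hxz⟩, hyz⟩
      · exact Or.inr ⟨hyo, ⟨hxy, hxz⟩, hyz⟩
    · rintro (⟨hxo, ⟨hxy, hxz⟩, hyz⟩ | ⟨hyo, ⟨hxy, hxz⟩, hyz⟩)
      · exact ⟨⟨⟨hxz, hyz, fun hoz => hxz (hxo.trans hoz)⟩, Or.inl hxo⟩, hxy⟩
      · exact ⟨⟨⟨hxz, hyz, fun hoz => hyz (hyo.trans hoz)⟩, Or.inr hyo⟩, hxy⟩
  have hdisj : Disjoint (openConn x o ∩ X) (openConn y o ∩ X) := by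
    rw [Set.disjoint_left]
    rintro ω ⟨hxo, ⟨hxy, -⟩, -⟩ ⟨hyo, -⟩
    exact hxy (hxo.trans hyo.symm)
  have e4m : μ.real (D ∩ Eo ∩ Aᶜ) = μ.real (openConn x o ∩ X) + μ.real (openConn y o ∩ X) := by
    rw [e4]; exact measureReal_union hdisj (hmeas _)
  rw [e1, e2, e3, e4m] at key
  linarith [key]


end PocketCert

end

end Summit.CriticalPhenomena.PercolationContinuityZ3.Theorems
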